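import Mathlib
import HarnessLib
import Literature.NumberTheory.LFunctions.HorocycleStripFourier
import Literature.NumberTheory.LFunctions.HorocyclePhase
import Literature.NumberTheory.LFunctions.HorocycleRHIncompleteEisenstein
import Literature.NumberTheory.LFunctions.HorocycleZeroMode

/-!
# Unfolding the horocycle average of an incomplete Poincaré series over `Γ_∞\Γ/Γ_∞`

Support file (all statements PROVED, no definitions, no named facts) for the elementary proof of
the unconditional rate `m_F(y) = c + O(y^{1/2})` of equidistribution of closed horocycles on
`SL(2,ℤ)\ℍ` (`Literature.NumberTheory.LFunctions.zagier_sarnak_horocycle_rate_half`; Sarnak 1981,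
Thm. 1; Zagier 1981, §1 (10)), continuing `HorocycleStripFourier.lean`, `HorocyclePhase.lean`
and generalising Part 2 of `HorocycleRHIncompleteEisenstein.lean` from incomplete Eisenstein
series (`x`-independent seeds `ψ(im z)`) to incomplete Poincaré series of a strip test `f`.

For a coprime pair `v = (c, d)` put `γ_v = (gcdA d c, -gcdB d c; c, d) ∈ SL(2,ℤ)`
(`gcdA_mul_add_gcdB_mul`) and `T_f(v, z) = f(γ_v z)` for `c ≠ 0`, `T_f((0,±1), z) = f z`; for a
`1`-periodic `f` this depends on the coset `Γ_∞ γ_v` only (`apply_moebius_eq_of_det`: two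
determinant-one integer matrices with the same bottom row differ by an integer translation,
`exists_eq_add_mul_of_det`). The incomplete Poincaré series is `P_f(z) = ∑_{(c,d)=1} T_f((c,d), z)`.
Main result (`horocycleAverage_poincare`): for `f` continuous, `1`-periodic, supported in
`a ≤ im z ≤ b` (`a > 0`), `y > 0` and `N ≥ 1/(ay) + √(y/a)`,
`∫₀¹ P_f(x+iy) dx = 2 ∫₀¹ f(x+iy) dx + 2 ∑_{1 ≤ c ≤ N} y ∑_{r mod c, (r,c)=1} Ψ(c²y, r/c)`,
`Ψ(w, θ) = ∫_ℝ f(θ - 1/(w(t+i))) dt` (Iwaniec, *Spectral methods*, §3.4 (3.17); Zagier 1981 §1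
(10)): only pairs in a box contribute on the segment (`summand_eq_zero_of_not_mem_pairBox`, via
the landed box lemma for the indicator of `[a, ∞)`), the row `c = 0` gives `2 ∫₀¹ f`
(`row_zero`), rows `±c` agree (`row_neg`), and for `c ≥ 1` the regrouping `d = cq + r` tiles `ℝ`
(`row_eq_sum_residues`: `γ_{c,d} z = gcdA d c/c - 1/(c(cz+d))`, `cell_eq_rowIntegral`, then
`u = yt`, `rowIntegral_eq_mul`), and `r ↦ gcdA r c` is the inversion on `(ℤ/c)ˣ`
(`sum_coprime_gcdA_eq`).

## References
* H. Iwaniec, *Spectral Methods of Automorphic Forms*, 2nd ed., AMS GSM 53 (2002), §2.4, §3.4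
  [Iwaniec2002].
* D. Zagier, *Eisenstein series and the Riemann zeta function*, in: Automorphic forms,
  representation theory and arithmetic (Bombay 1979), Springer 1981, 275–301, §1 [Zagier1981].
* P. Sarnak, *Asymptotic behavior of periodic orbits of the horocycle flow and Eisenstein
  series*, Comm. Pure Appl. Math. 34 (1981), 719–739, Thm. 1 [Sarnak1981].

## Mathlib search
`UpperHalfPlane.specialLinearGroup_apply`, `ModularGroup.im_smul_eq_div_normSq`,
`ModularGroup.denom_apply`, `Int.gcd_eq_gcd_ab`, `Int.ediv_emod_unique`, `Finset.sum_nbij`;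
tree: `Literature.NumberTheory.LFunctions.pairBox`, `coprimePairBox`,
`incEisTerm_eq_zero_of_not_mem_pairBox` (`HorocycleRHIncompleteEisenstein.lean`),
`HorocycleZeroMode.sum_Ioc_zero_eq_sum_range`.
-/

noncomputable section

open Complex MeasureTheory Set Filter Topology intervalIntegral
open scoped Real ContDiff MatrixGroups UpperHalfPlane

namespace Literature.NumberTheory.LFunctions

namespace HorocycleUnfolding

open HorocycleStripFourier HorocyclePhase

variable {f : ℂ → ℂ} {a b : ℝ}

/-! ### Integer matrices of determinant one with a prescribed bottom row -/

/-- For a coprime pair `(c, d)`, `(gcdA d c, -gcdB d c; c, d)` has determinant one: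
`gcdA d c · d + gcdB d c · c = 1`. [folklore] -/
theorem gcdA_mul_add_gcdB_mul {c d : ℤ} (h : IsCoprime c d) :
    Int.gcdA d c * d + Int.gcdB d c * c = 1 := by
  have h1 : Int.gcd d c = 1 := by
    rw [Int.gcd_comm]; exact Int.isCoprime_iff_gcd_eq_one.mp h
  have h2 := Int.gcd_eq_gcd_ab d c
  rw [h1] at h2
  push_cast at h2
  linarith [h2]

/-- **Two determinant-one integer matrices with the same bottom row `(c, d)`, `c ≠ 0`, differ by
an integer translation**: `A' = A + nc`, `B' = B + nd`. [folklore] -/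
theorem exists_eq_add_mul_of_det {A B A' B' c d : ℤ} (hc : c ≠ 0) (h1 : A * d - B * c = 1)
    (h2 : A' * d - B' * c = 1) : ∃ n : ℤ, A' = A + n * c ∧ B' = B + n * d := by
  have hcop : IsCoprime c d := ⟨-B, A, by linarith⟩
  have hdvd : c ∣ (A' - A) * d := ⟨B' - B, by linarith⟩
  obtain ⟨n, hn⟩ := hcop.dvd_of_dvd_mul_right hdvd
  refine ⟨n, by linarith, ?_⟩
  have : (B' - B) * c = n * d * c := by
    have e : (A' - A) * d = (B' - B) * c := by linarith
    rw [← e, hn]; ring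
  have := mul_right_cancel₀ hc this
  linarith

/-- … hence a `1`-periodic `f` takes the same value at the two Möbius images. [folklore] -/
theorem apply_moebius_eq_of_det (hper : ∀ z, f (z + 1) = f z) {A B A' B' c d : ℤ} (hc : c ≠ 0)
    (h1 : A * d - B * c = 1) (h2 : A' * d - B' * c = 1) {z : ℂ} (hz : (c : ℂ) * z + d ≠ 0) :
    f (((A' : ℂ) * z + B') / ((c : ℂ) * z + d)) = f (((A : ℂ) * z + B) / ((c : ℂ) * z + d)) := by
  obtain ⟨n, hA, hB⟩ := exists_eq_add_mul_of_det hc h1 h2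
  have e : ((A' : ℂ) * z + B') / ((c : ℂ) * z + d) = ((A : ℂ) * z + B) / ((c : ℂ) * z + d) + n := by
    rw [hA, hB]; push_cast; field_simp; ring
  rw [e, periodic_int hper]

/-- The Möbius image in "unfolded" form: `(Az + B)/(cz + d) = A/c - 1/(c(cz + d))` when
`Ad - Bc = 1`, `c ≠ 0`. [folklore] -/
theorem moebius_eq_sub_inv {A B c d : ℤ} (hc : c ≠ 0) (h1 : A * d - B * c = 1) {z : ℂ}
    (hz : (c : ℂ) * z + d ≠ 0) :
    ((A : ℂ) * z + B) / ((c : ℂ) * z + d) = (A : ℂ) / c - 1 / ((c : ℂ) * ((c : ℂ) * z + d)) := by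
  have hc' : (c : ℂ) ≠ 0 := Int.cast_ne_zero.mpr hc
  have h1' : (A : ℂ) * d - B * c = 1 := by exact_mod_cast h1
  rw [div_sub_div _ _ hc' (mul_ne_zero hc' hz), div_eq_div_iff hz (mul_ne_zero hc' (mul_ne_zero hc' hz))]
  linear_combination (-((c : ℂ) * ((c : ℂ) * z + d))) * h1'

/-- On a horizontal line `im z = y > 0` the denominator `cz + d` (`c ≠ 0`) does not vanish.
[folklore] -/
theorem denom_ne_zero {c : ℤ} (hc : c ≠ 0) (d : ℤ) {z : ℂ} (hz : 0 < z.im) :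
    (c : ℂ) * z + d ≠ 0 := by
  intro h
  have := congrArg Complex.im h
  simp only [add_im, mul_im, intCast_re, intCast_im, zero_mul, add_zero, zero_im] at this
  rcases mul_eq_zero.mp this with h0 | h0
  · exact hc (by exact_mod_cast h0)
  · exact absurd h0 hz.ne'

/-! ### The action of `SL(2,ℤ)` in coordinates -/

/-- `↑(g • z) = (g₀₀ z + g₀₁)/(g₁₀ z + g₁₁)`. [folklore] -/
theorem coe_smul_eq (g : SL(2, ℤ)) (z : ℍ) :
    ((g • z : ℍ) : ℂ) = ((g 0 0 : ℂ) * z + g 0 1) / ((g 1 0 : ℂ) * z + g 1 1) := by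
  rw [UpperHalfPlane.specialLinearGroup_apply]
  simp

/-- `im (g • z) = im z / |g₁₀ z + g₁₁|²`. [folklore] -/
theorem im_smul_eq (g : SL(2, ℤ)) (z : ℍ) :
    (g • z).im = z.im / Complex.normSq ((g 1 0 : ℂ) * z + g 1 1) := by
  rw [ModularGroup.im_smul_eq_div_normSq, ModularGroup.denom_apply]

/-- For `g ∈ SL(2,ℤ)` with `g₁₀ ≠ 0` and a `1`-periodic `f`:
`f(g • z) = f((gcdA g₁₁ g₁₀ · z - gcdB g₁₁ g₁₀)/(g₁₀ z + g₁₁))` — the value depends on the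
bottom row only. [folklore] -/
theorem apply_smul_eq (hper : ∀ z, f (z + 1) = f z) (g : SL(2, ℤ)) (hc : g 1 0 ≠ 0) (z : ℍ) :
    f ((g • z : ℍ) : ℂ) =
      f (((Int.gcdA (g 1 1) (g 1 0) : ℂ) * z - (Int.gcdB (g 1 1) (g 1 0) : ℂ)) /
        ((g 1 0 : ℂ) * z + g 1 1)) := by
  rw [coe_smul_eq]
  have h1 : g 0 0 * g 1 1 - g 0 1 * g 1 0 = 1 := by
    have := Matrix.SpecialLinearGroup.det_coe g
    rwa [Matrix.det_fin_two] at this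
  have hcop : IsCoprime (g 1 0) (g 1 1) := ⟨-(g 0 1), g 0 0, by linarith⟩
  have h2 := gcdA_mul_add_gcdB_mul hcop
  have hz : ((g 1 0 : ℤ) : ℂ) * (z : ℂ) + (g 1 1 : ℤ) ≠ 0 := denom_ne_zero hc _ z.im_pos
  have := apply_moebius_eq_of_det hper (A := Int.gcdA (g 1 1) (g 1 0))
    (B := -Int.gcdB (g 1 1) (g 1 0)) (A' := g 0 0) (B' := g 0 1) hc (by linarith) (by linarith) hz
  rw [this]
  push_cast
  ring_nf


/-! ### The summand of the incomplete Poincaré series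

For a coprime pair `v = (c, d)` and `z ∈ ℍ` the summand is `f(γ_v z)` with
`γ_v = (gcdA d c, -gcdB d c; c, d) ∈ SL(2,ℤ)` for `c ≠ 0`, and `f z` for `c = 0` (`d = ±1`):
`T_f(v, z) = if c = 0 then f z else f((gcdA d c · z - gcdB d c)/(cz + d))`. -/

/-- `↑(g • z)` and the explicit Möbius image built from the bottom row of `g` differ by an
integer. [folklore] -/
theorem exists_coe_smul_eq_add_int (g : SL(2, ℤ)) (hc : g 1 0 ≠ 0) (z : ℍ) :
    ∃ n : ℤ, ((g • z : ℍ) : ℂ) =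
      ((Int.gcdA (g 1 1) (g 1 0) : ℂ) * z - (Int.gcdB (g 1 1) (g 1 0) : ℂ)) /
        ((g 1 0 : ℂ) * z + g 1 1) + n := by
  have h1 : g 0 0 * g 1 1 - g 0 1 * g 1 0 = 1 := by
    have := Matrix.SpecialLinearGroup.det_coe g
    rwa [Matrix.det_fin_two] at this
  have hcop : IsCoprime (g 1 0) (g 1 1) := ⟨-(g 0 1), g 0 0, by linarith⟩
  have h2 := gcdA_mul_add_gcdB_mul hcop
  obtain ⟨n, hA, hB⟩ := exists_eq_add_mul_of_det (A := Int.gcdA (g 1 1) (g 1 0))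
    (B := -Int.gcdB (g 1 1) (g 1 0)) (A' := g 0 0) (B' := g 0 1) (c := g 1 0) (d := g 1 1) hc
    (by linarith) (by linarith)
  have hz : ((g 1 0 : ℤ) : ℂ) * (z : ℂ) + (g 1 1 : ℤ) ≠ 0 := denom_ne_zero hc _ z.im_pos
  refine ⟨n, ?_⟩
  rw [coe_smul_eq, hA, hB]
  push_cast
  field_simp
  ring

/-- The height of the explicit Möbius image: `im z / |cz + d|²`. [folklore] -/
theorem im_moebius_eq {c d : ℤ} (h : IsCoprime c d) (hc : c ≠ 0) (z : ℍ) :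
    (((Int.gcdA d c : ℂ) * z - (Int.gcdB d c : ℂ)) / ((c : ℂ) * z + d)).im =
      z.im / Complex.normSq ((c : ℂ) * z + d) := by
  obtain ⟨g, hg0, hg1⟩ := h.exists_SL2_row 1
  subst hg0 hg1
  obtain ⟨n, hn⟩ := exists_coe_smul_eq_add_int g hc z
  have := im_smul_eq g z
  rw [← UpperHalfPlane.coe_im, hn] at this
  simpa using this

/-- The summand vanishes outside the box `pairBox N` on `y ≤ im z ≤ Y`, `|re z| ≤ X`
(`N ≥ 1/(ay)`, `N ≥ X/(ay) + √(Y/a)`), for `f` supported in `im ≥ a > 0`: its argument has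
height `im z/|cz+d|² < a` there (the box lemma `incEisTerm_eq_zero_of_not_mem_pairBox` applied to
the indicator of `[a, ∞)`). [folklore] -/
theorem summand_eq_zero_of_not_mem_pairBox (hsupp : ∀ z, f z ≠ 0 → a ≤ z.im ∧ z.im ≤ b)
    (ha : 0 < a) {y X Y : ℝ} (hy : 0 < y) {N : ℕ} (hN₀ : 1 / (a * y) ≤ N)
    (hN₁ : 1 / (a * y) * X + Real.sqrt (Y / a) ≤ N) {z : ℂ} (hz₁ : y ≤ z.im) (hz₂ : z.im ≤ Y)
    (hz₃ : |z.re| ≤ X) {v : Fin 2 → ℤ} (hcop : IsCoprime (v 0) (v 1)) (hv : v ∉ pairBox N) :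
    (if v 0 = 0 then f z else
      f (((Int.gcdA (v 1) (v 0) : ℂ) * z - (Int.gcdB (v 1) (v 0) : ℂ)) / ((v 0 : ℂ) * z + v 1))) =
      0 := by
  have hz0 : 0 < z.im := lt_of_lt_of_le hy hz₁
  have hN1 : 1 ≤ N := by
    have : (0:ℝ) < N := lt_of_lt_of_le (by positivity) hN₀
    exact_mod_cast this
  split_ifs with h0
  · -- `v = (0, ±1)` lies in every box with `N ≥ 1`
    exfalso; apply hv
    rw [mem_pairBox]
    have hu : IsUnit (v 1) := by rw [h0] at hcop; exact isCoprime_zero_left.mp hcop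
    intro i; fin_cases i
    · simp [h0]
    · rcases Int.isUnit_iff.mp hu with h1 | h1 <;> simp [h1] <;> exact_mod_cast hN1
  · by_contra hne
    have hge := (hsupp _ hne).1
    rw [show z = ((⟨z, hz0⟩ : ℍ) : ℂ) from rfl, im_moebius_eq hcop h0 ⟨z, hz0⟩] at hge
    -- the box lemma for the indicator of `[a, ∞)`
    set ψ : ℝ → ℝ := Set.indicator (Set.Ici a) (fun _ => (1:ℝ)) with hψ
    have hψa : ∀ t, ψ t ≠ 0 → a ≤ t := fun t ht => by
      by_contra hlt
      exact ht (Set.indicator_of_notMem (by simpa using hlt) _)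
    have h := incEisTerm_eq_zero_of_not_mem_pairBox ha hψa hy hN₀ hN₁ hz₁ hz₂ hz₃ hv
    rw [incEisTerm, hψ, Set.indicator_apply_eq_zero] at h
    exact one_ne_zero (h hge)

/-- On a horizontal box only the pairs in `coprimePairBox N` contribute. [folklore] -/
theorem tsum_summand_eq_finsetSum (hsupp : ∀ z, f z ≠ 0 → a ≤ z.im ∧ z.im ≤ b) (ha : 0 < a)
    {y X Y : ℝ} (hy : 0 < y) {N : ℕ} (hN₀ : 1 / (a * y) ≤ N)
    (hN₁ : 1 / (a * y) * X + Real.sqrt (Y / a) ≤ N) {z : ℂ} (hz₁ : y ≤ z.im) (hz₂ : z.im ≤ Y)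
    (hz₃ : |z.re| ≤ X) :
    (∑' v : coprimePairs, (if v.1 0 = 0 then f z else
      f (((Int.gcdA (v.1 1) (v.1 0) : ℂ) * z - (Int.gcdB (v.1 1) (v.1 0) : ℂ)) /
        ((v.1 0 : ℂ) * z + v.1 1)))) =
      ∑ v ∈ coprimePairBox N, (if v.1 0 = 0 then f z else
        f (((Int.gcdA (v.1 1) (v.1 0) : ℂ) * z - (Int.gcdB (v.1 1) (v.1 0) : ℂ)) /
          ((v.1 0 : ℂ) * z + v.1 1))) := by
  apply tsum_eq_sum
  intro v hv
  apply summand_eq_zero_of_not_mem_pairBox hsupp ha hy hN₀ hN₁ hz₁ hz₂ hz₃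
    ((EisensteinSeries.mem_gammaSet_one _).mp v.2)
  classical
  simpa [coprimePairBox, Finset.mem_subtype] using hv

/-- Continuity of the summand along the horocycle segment. [folklore] -/
theorem continuous_summand_horocycle (hfc : Continuous f) (v : Fin 2 → ℤ) {y : ℝ} (hy : 0 < y) :
    Continuous fun x : ℝ => (if v 0 = 0 then f ((x : ℂ) + y * I) else
      f (((Int.gcdA (v 1) (v 0) : ℂ) * ((x : ℂ) + y * I) - (Int.gcdB (v 1) (v 0) : ℂ)) /
        ((v 0 : ℂ) * ((x : ℂ) + y * I) + v 1))) := by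
  by_cases h0 : v 0 = 0
  · simp only [h0, if_true]; fun_prop
  · simp only [h0, if_false]
    refine hfc.comp (Continuous.div (by fun_prop) (by fun_prop) fun x => ?_)
    exact denom_ne_zero h0 _ (by simpa using hy)

/-! ### Step 1: the horocycle integral as a finite sum of cells -/

open scoped Classical in
/-- `∫₀¹ P_f(x+iy) dx = ∑_{v ∈ pairBox N, v coprime} ∫₀¹ T_f(v, x+iy) dx` for `N` large.
[folklore] -/
theorem horocycle_integral_eq_boxSum (hfc : Continuous f)
    (hsupp : ∀ z, f z ≠ 0 → a ≤ z.im ∧ z.im ≤ b) (ha : 0 < a) {y : ℝ} (hy : 0 < y) {N : ℕ}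
    (hN₀ : 1 / (a * y) ≤ N) (hN₁ : 1 / (a * y) * 1 + Real.sqrt (y / a) ≤ N) :
    ∫ x in (0:ℝ)..1, (∑' v : coprimePairs, (if v.1 0 = 0 then f ((x : ℂ) + y * I) else
      f (((Int.gcdA (v.1 1) (v.1 0) : ℂ) * ((x : ℂ) + y * I) - (Int.gcdB (v.1 1) (v.1 0) : ℂ)) /
        ((v.1 0 : ℂ) * ((x : ℂ) + y * I) + v.1 1)))) =
      ∑ v ∈ pairBox N, if IsCoprime (v 0) (v 1) then
        ∫ x in (0:ℝ)..1, (if v 0 = 0 then f ((x : ℂ) + y * I) else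
          f (((Int.gcdA (v 1) (v 0) : ℂ) * ((x : ℂ) + y * I) - (Int.gcdB (v 1) (v 0) : ℂ)) /
            ((v 0 : ℂ) * ((x : ℂ) + y * I) + v 1))) else 0 := by
  have hseg : ∀ x ∈ Set.uIcc (0 : ℝ) 1,
      (∑' v : coprimePairs, (if v.1 0 = 0 then f ((x : ℂ) + y * I) else
        f (((Int.gcdA (v.1 1) (v.1 0) : ℂ) * ((x : ℂ) + y * I) - (Int.gcdB (v.1 1) (v.1 0) : ℂ)) /
          ((v.1 0 : ℂ) * ((x : ℂ) + y * I) + v.1 1)))) =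
      ∑ v ∈ coprimePairBox N, (if v.1 0 = 0 then f ((x : ℂ) + y * I) else
        f (((Int.gcdA (v.1 1) (v.1 0) : ℂ) * ((x : ℂ) + y * I) - (Int.gcdB (v.1 1) (v.1 0) : ℂ)) /
          ((v.1 0 : ℂ) * ((x : ℂ) + y * I) + v.1 1))) := by
    intro x hx
    rw [Set.uIcc_of_le zero_le_one] at hx
    refine tsum_summand_eq_finsetSum hsupp ha hy hN₀ hN₁ (by simp) (by simp) ?_
    simpa [abs_le] using And.intro (by linarith [hx.1]) hx.2
  rw [intervalIntegral.integral_congr hseg]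
  have hint : ∀ v ∈ coprimePairBox N, IntervalIntegrable (fun x : ℝ =>
      (if v.1 0 = 0 then f ((x : ℂ) + y * I) else
        f (((Int.gcdA (v.1 1) (v.1 0) : ℂ) * ((x : ℂ) + y * I) - (Int.gcdB (v.1 1) (v.1 0) : ℂ)) /
          ((v.1 0 : ℂ) * ((x : ℂ) + y * I) + v.1 1)))) volume 0 1 :=
    fun v _ => (continuous_summand_horocycle hfc v.1 hy).intervalIntegrable _ _
  rw [intervalIntegral.integral_finsetSum hint]
  unfold coprimePairBox
  rw [Finset.sum_subtype_eq_sum_filter (f := fun v : Fin 2 → ℤ => ∫ x in (0:ℝ)..1,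
      (if v 0 = 0 then f ((x : ℂ) + y * I) else
        f (((Int.gcdA (v 1) (v 0) : ℂ) * ((x : ℂ) + y * I) - (Int.gcdB (v 1) (v 0) : ℂ)) /
          ((v 0 : ℂ) * ((x : ℂ) + y * I) + v 1)))),
    Finset.sum_filter]
  refine Finset.sum_congr rfl fun v _ => ?_
  simp only [coprimePairs, EisensteinSeries.mem_gammaSet_one]

/-! ### Step 2: rows -/

/-- The box sum as a double sum over `c` and `d`. [folklore] -/
theorem sum_pairBox_eq' {M : Type*} [AddCommMonoid M] (N : ℕ) (G : ℤ → ℤ → M) :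
    ∑ v ∈ pairBox N, G (v 0) (v 1) =
      ∑ c ∈ Finset.Icc (-(N : ℤ)) N, ∑ d ∈ Finset.Icc (-(N : ℤ)) N, G c d := by
  rw [← Finset.sum_product (Finset.Icc (-(N : ℤ)) N) (Finset.Icc (-(N : ℤ)) N)
    (fun p : ℤ × ℤ => G p.1 p.2)]
  refine Finset.sum_equiv (finTwoArrowEquiv ℤ) (fun v => ?_) (fun v _ => rfl)
  rw [mem_pairBox, Finset.mem_product, Finset.mem_Icc, Finset.mem_Icc, Fin.forall_fin_two, abs_le,
    abs_le]
  exact Iff.rfl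

/-- A sum over `|c| ≤ N` of an even function: `h 0 + 2 ∑_{1 ≤ c ≤ N} h c`. [folklore] -/
theorem sum_Icc_symm' {h : ℤ → ℂ} (hh : ∀ c, h (-c) = h c) (N : ℕ) :
    ∑ c ∈ Finset.Icc (-(N : ℤ)) N, h c = h 0 + 2 * ∑ k ∈ Finset.range N, h ((k : ℤ) + 1) := by
  have himg : Finset.Icc (-(N : ℤ)) N =
      (Finset.range (N + (N + 1))).image (fun k : ℕ => (k : ℤ) - N) := by
    ext c
    simp only [Finset.mem_Icc, Finset.mem_image, Finset.mem_range]
    constructor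
    · rintro ⟨h1, h2⟩; exact ⟨(c + N).toNat, by omega, by omega⟩
    · rintro ⟨k, hk, rfl⟩; omega
  rw [himg, Finset.sum_image (fun (k : ℕ) _ (l : ℕ) _ (hkl : (k : ℤ) - N = (l : ℤ) - N) => by omega)]
  rw [Finset.sum_range_add, Finset.sum_range_succ']
  have e1 : ∑ k ∈ Finset.range N, h ((k : ℤ) - N) = ∑ k ∈ Finset.range N, h ((k : ℤ) + 1) := by
    rw [← Finset.sum_range_reflect (fun k => h ((k : ℤ) + 1)) N]
    refine Finset.sum_congr rfl fun k hk => ?_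
    rw [Finset.mem_range] at hk
    calc h ((k : ℤ) - N) = h (-((k : ℤ) - N)) := (hh _).symm
      _ = h (((N - 1 - k : ℕ) : ℤ) + 1) := by congr 1; omega
  have e2 : ∑ k ∈ Finset.range N, h (((N + (k + 1) : ℕ) : ℤ) - N) =
      ∑ k ∈ Finset.range N, h ((k : ℤ) + 1) := by
    refine Finset.sum_congr rfl fun k _ => ?_
    congr 1; push_cast; ring
  have e3 : h (((N + 0 : ℕ) : ℤ) - N) = h 0 := by congr 1; push_cast; ring
  rw [e1, e2, e3]; ring

/-- The row `c = 0`: only `d = ±1` are coprime to `0`, each cell being `∫₀¹ f(x+iy) dx`.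
[folklore] -/
theorem row_zero (f : ℂ → ℂ) (y : ℝ) {N : ℕ} (hN : 1 ≤ N) :
    (∑ d ∈ Finset.Icc (-(N : ℤ)) N, if IsCoprime (0:ℤ) d then
        ∫ x in (0:ℝ)..1, (if (0:ℤ) = 0 then f ((x : ℂ) + y * I) else
          f (((Int.gcdA d 0 : ℂ) * ((x : ℂ) + y * I) - (Int.gcdB d 0 : ℂ)) /
            (((0:ℤ) : ℂ) * ((x : ℂ) + y * I) + d))) else 0) =
      2 * ∫ x in (0:ℝ)..1, f ((x : ℂ) + y * I) := by
  classical
  simp only [if_true]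
  have h1 : ∀ d : ℤ, IsCoprime 0 d ↔ d = 1 ∨ d = -1 := fun d => by
    rw [isCoprime_zero_left, Int.isUnit_iff]
  simp_rw [h1]
  rw [← Finset.sum_filter]
  have hfil : (Finset.Icc (-(N : ℤ)) N).filter (fun d => d = 1 ∨ d = -1) = {1, -1} := by
    ext d
    simp only [Finset.mem_filter, Finset.mem_Icc, Finset.mem_insert, Finset.mem_singleton]
    omega
  rw [hfil, Finset.sum_pair (by norm_num), two_mul]

/-- Cell symmetry `T_f((-c,-d), z) = T_f((c,d), z)` for `c ≠ 0` (both come from determinant-one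
matrices with bottom row `±(c, d)`). [folklore] -/
theorem summand_neg_neg (hper : ∀ z, f (z + 1) = f z) {c d : ℤ} (hc : c ≠ 0)
    (hcop : IsCoprime c d) {z : ℂ} (hz : 0 < z.im) :
    f (((Int.gcdA (-d) (-c) : ℂ) * z - (Int.gcdB (-d) (-c) : ℂ)) / (((-c : ℤ) : ℂ) * z + (-d : ℤ))) =
      f (((Int.gcdA d c : ℂ) * z - (Int.gcdB d c : ℂ)) / ((c : ℂ) * z + d)) := by
  have hcop' : IsCoprime (-c) (-d) := hcop.neg_left.neg_right
  have h2 := gcdA_mul_add_gcdB_mul hcop'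
  have h1 := gcdA_mul_add_gcdB_mul hcop
  have hzne : (c : ℂ) * z + d ≠ 0 := denom_ne_zero hc d hz
  have e : ((Int.gcdA (-d) (-c) : ℂ) * z - (Int.gcdB (-d) (-c) : ℂ)) / (((-c : ℤ) : ℂ) * z + (-d : ℤ)) =
      (((-Int.gcdA (-d) (-c) : ℤ) : ℂ) * z + (Int.gcdB (-d) (-c) : ℤ)) / ((c : ℂ) * z + d) := by
    have : (((-c : ℤ) : ℂ) * z + (-d : ℤ)) = -((c : ℂ) * z + d) := by push_cast; ring
    rw [this, div_neg, ← neg_div]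
    congr 1; push_cast; ring
  rw [e]
  have := apply_moebius_eq_of_det hper (A := Int.gcdA d c) (B := -Int.gcdB d c)
    (A' := -Int.gcdA (-d) (-c)) (B' := Int.gcdB (-d) (-c)) hc (by linarith) (by linarith) hzne
  rw [this]
  congr 1; push_cast; ring

/-- Row symmetry: the row sums for `-c` and `c` agree (reindex `d ↦ -d`). [folklore] -/
theorem row_neg (hper : ∀ z, f (z + 1) = f z) {y : ℝ} (hy : 0 < y) (N : ℕ) (c : ℤ) :
    (∑ d ∈ Finset.Icc (-(N : ℤ)) N, if IsCoprime (-c) d then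
        ∫ x in (0:ℝ)..1, (if -c = 0 then f ((x : ℂ) + y * I) else
          f (((Int.gcdA d (-c) : ℂ) * ((x : ℂ) + y * I) - (Int.gcdB d (-c) : ℂ)) /
            (((-c : ℤ) : ℂ) * ((x : ℂ) + y * I) + d))) else 0) =
      ∑ d ∈ Finset.Icc (-(N : ℤ)) N, if IsCoprime c d then
        ∫ x in (0:ℝ)..1, (if c = 0 then f ((x : ℂ) + y * I) else
          f (((Int.gcdA d c : ℂ) * ((x : ℂ) + y * I) - (Int.gcdB d c : ℂ)) /
            ((c : ℂ) * ((x : ℂ) + y * I) + d))) else 0 := by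
  refine Finset.sum_equiv (Equiv.neg ℤ) (fun d => ?_) (fun d _ => ?_)
  · simp only [Finset.mem_Icc, Equiv.neg_apply]; omega
  · simp only [Equiv.neg_apply, IsCoprime.neg_left_iff, IsCoprime.neg_right_iff, neg_eq_zero]
    by_cases hc : c = 0
    · simp [hc]
    · simp only [hc, if_false]
      split_ifs with hcd
      · refine intervalIntegral.integral_congr fun x _ => ?_
        have hz : (0:ℝ) < (((x : ℂ) + y * I)).im := by simpa using hy
        have := summand_neg_neg hper hc hcd.neg_right hz
        simpa using this
      · rfl


/-! ### Step 3: the rows `c ≥ 1` -/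

/-- `1/(C(u+iy)) = u/(C(u²+y²)) - i y/(C(u²+y²))`. [folklore] -/
theorem one_div_mul_add_mul_I {C y : ℝ} (hC : C ≠ 0) (hy : y ≠ 0) (u : ℝ) :
    (1 : ℂ) / ((C : ℂ) * ((u : ℂ) + (y : ℂ) * I)) =
      ((u / (C * (u ^ 2 + y ^ 2)) : ℝ) : ℂ) - ((y / (C * (u ^ 2 + y ^ 2)) : ℝ) : ℂ) * I := by
  have huy : (u : ℂ) + (y : ℂ) * I ≠ 0 := by
    intro h; have := congrArg Complex.im h; simp at this; exact hy this
  have hne : (C : ℂ) * ((u : ℂ) + (y : ℂ) * I) ≠ 0 := mul_ne_zero (ofReal_ne_zero.mpr hC) huy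
  have h2 : (u ^ 2 + y ^ 2 : ℝ) ≠ 0 := by
    intro h; apply hy; nlinarith [sq_nonneg u, sq_nonneg y]
  rw [div_eq_iff hne]
  apply Complex.ext
  · simp only [one_re, sub_re, ofReal_re, mul_re, I_re, mul_zero, ofReal_im, I_im, mul_one,
      sub_self, add_re, add_im, mul_im, zero_add, sub_im, zero_sub, add_zero]
    field_simp
    ring
  · simp only [one_im, sub_im, ofReal_im, mul_im, I_re, mul_zero, ofReal_re, I_im, mul_one,
      zero_add, add_re, add_im, mul_re, sub_re, zero_sub, add_zero, sub_self]
    field_simp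
    ring

/-- Height of the row integrand's argument: `im(θ - 1/(C(u+iy))) = y/(C(u²+y²))`. [folklore] -/
theorem im_sub_one_div {C y : ℝ} (hC : C ≠ 0) (hy : y ≠ 0) (θ u : ℝ) :
    ((θ : ℂ) - 1 / ((C : ℂ) * ((u : ℂ) + (y : ℂ) * I))).im = y / (C * (u ^ 2 + y ^ 2)) := by
  rw [one_div_mul_add_mul_I hC hy u]
  simp only [sub_im, ofReal_im, mul_im, ofReal_re, I_im, mul_one, I_re, mul_zero, add_zero,
    zero_sub, neg_neg]

/-- Support of the row integrand: `f(θ - 1/(c²(u+iy))) ≠ 0` (`c ≥ 1`, `y > 0`) forces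
`|u| ≤ √(y/a)`. [folklore] -/
theorem abs_le_of_rowIntegrand_ne_zero (hsupp : ∀ z, f z ≠ 0 → a ≤ z.im ∧ z.im ≤ b) (ha : 0 < a)
    {c : ℕ} (hc : 1 ≤ c) {y : ℝ} (hy : 0 < y) {θ u : ℝ}
    (h : f ((θ : ℂ) - 1 / ((((c : ℝ) ^ 2 : ℝ)) * ((u : ℂ) + (y : ℂ) * I))) ≠ 0) :
    |u| ≤ Real.sqrt (y / a) := by
  have hcR : (1 : ℝ) ≤ c := by exact_mod_cast hc
  have hC : ((c : ℝ) ^ 2 : ℝ) ≠ 0 := by positivity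
  have h1 := (hsupp _ h).1
  rw [im_sub_one_div hC hy.ne' θ u] at h1
  have hpos : 0 < (c : ℝ) ^ 2 * (u ^ 2 + y ^ 2) := by positivity
  rw [le_div_iff₀ hpos] at h1
  rw [← Real.sqrt_sq_eq_abs]
  apply Real.sqrt_le_sqrt
  rw [le_div_iff₀ ha]
  have hc2 : (1 : ℝ) ≤ (c : ℝ) ^ 2 := by nlinarith
  have h2 : a * u ^ 2 ≤ a * ((c : ℝ) ^ 2 * (u ^ 2 + y ^ 2)) := by
    have e : a * ((c : ℝ) ^ 2 * (u ^ 2 + y ^ 2)) - a * u ^ 2 =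
        a * u ^ 2 * ((c : ℝ) ^ 2 - 1) + a * ((c : ℝ) ^ 2 * y ^ 2) := by ring
    have : 0 ≤ a * u ^ 2 * ((c : ℝ) ^ 2 - 1) + a * ((c : ℝ) ^ 2 * y ^ 2) := by positivity
    linarith
  linarith

/-- `gcdA` of congruent second arguments differ by a multiple of the modulus:
`gcdA (cq + r) c = gcdA r c + nc`. [folklore] -/
theorem exists_gcdA_eq_add_mul {c r : ℤ} (hc : c ≠ 0) (h : IsCoprime c r) (q : ℤ) :
    ∃ n : ℤ, Int.gcdA (c * q + r) c = Int.gcdA r c + n * c := by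
  have h1 := gcdA_mul_add_gcdB_mul h
  have hcop' : IsCoprime c (c * q + r) := by
    rw [add_comm]; exact (IsCoprime.add_mul_left_right_iff).mpr h
  have h2 := gcdA_mul_add_gcdB_mul hcop'
  obtain ⟨n, hn, -⟩ := exists_eq_add_mul_of_det (A := Int.gcdA r c)
    (B := q * Int.gcdA r c - Int.gcdB r c) (A' := Int.gcdA (c * q + r) c)
    (B' := -Int.gcdB (c * q + r) c) (c := c) (d := c * q + r) hc (by linear_combination h1)
    (by linarith)
  exact ⟨n, hn⟩

/-- **Cell formula.** For `c ≥ 1` and any `d`, the cell integral is a unit-length piece of the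
row integral: `∫₀¹ f(γ_{c,d}(x+iy)) dx = ∫_{d/c}^{d/c+1} f(gcdA d c/c - 1/(c²(u+iy))) du`
(`γ z = A/c - 1/(c(cz+d))`, then `u = x + d/c`). [folklore] -/
theorem cell_eq_rowIntegral {c : ℕ} (hc : 1 ≤ c) {d : ℤ} (hcop : IsCoprime (c : ℤ) d) {y : ℝ}
    (hy : 0 < y) :
    ∫ x in (0:ℝ)..1, f (((Int.gcdA d c : ℂ) * ((x : ℂ) + y * I) - (Int.gcdB d c : ℂ)) /
        (((c : ℤ) : ℂ) * ((x : ℂ) + y * I) + d)) =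
      ∫ u in ((d : ℝ) / c)..((d : ℝ) / c + 1),
        f ((((Int.gcdA d c : ℝ) / c : ℝ) : ℂ) - 1 / ((((c : ℝ) ^ 2 : ℝ)) * ((u : ℂ) + (y : ℂ) * I))) := by
  have hc0 : (c : ℤ) ≠ 0 := by exact_mod_cast (show c ≠ 0 by omega)
  have hcC : ((c : ℤ) : ℂ) ≠ 0 := Int.cast_ne_zero.mpr hc0
  have h1 := gcdA_mul_add_gcdB_mul hcop
  have key : ∀ x : ℝ, f (((Int.gcdA d c : ℂ) * ((x : ℂ) + y * I) - (Int.gcdB d c : ℂ)) /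
      (((c : ℤ) : ℂ) * ((x : ℂ) + y * I) + d)) =
      f ((((Int.gcdA d c : ℝ) / c : ℝ) : ℂ) -
        1 / ((((c : ℝ) ^ 2 : ℝ)) * ((((x + d / c : ℝ)) : ℂ) + (y : ℂ) * I))) := by
    intro x
    have hz : ((c : ℤ) : ℂ) * ((x : ℂ) + y * I) + d ≠ 0 := denom_ne_zero hc0 d (by simpa using hy)
    have hcC' : ((c : ℕ) : ℂ) ≠ 0 := by exact_mod_cast (show c ≠ 0 by omega)
    have e := moebius_eq_sub_inv (A := Int.gcdA d c) (B := -Int.gcdB d c) hc0 (by linarith) hz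
    push_cast at e ⊢
    simp only [sub_eq_add_neg] at e ⊢
    rw [e]
    congr 4
    field_simp
    ring
  simp_rw [key]
  have := intervalIntegral.integral_comp_add_right (a := 0) (b := 1)
    (fun u : ℝ => f ((((Int.gcdA d c : ℝ) / c : ℝ) : ℂ) -
      1 / ((((c : ℝ) ^ 2 : ℝ)) * ((u : ℂ) + (y : ℂ) * I)))) ((d : ℝ) / c)
  simp only [zero_add] at this
  rw [this, add_comm]

/-- Tiling: `∑_{k < K} ∫_{k+t}^{k+t+1} g = ∫_ℝ g` when `support g ⊆ (t, K + t]`. [folklore] -/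
theorem sum_integral_unit_intervals' {g : ℝ → ℂ} (hg : Continuous g) (t : ℝ) (K : ℕ)
    (hsupp : Function.support g ⊆ Set.Ioc t (K + t)) :
    ∑ k ∈ Finset.range K, ∫ u in ((k : ℝ) + t)..((k : ℝ) + t + 1), g u = ∫ u, g u := by
  have := intervalIntegral.sum_integral_adjacent_intervals (f := g) (μ := volume)
    (a := fun k : ℕ => (k : ℝ) + t) (n := K) (fun k _ => (hg.intervalIntegrable _ _))
  simp only [Nat.cast_zero, zero_add] at this
  have e : ∀ k : ℕ, (((k + 1 : ℕ) : ℝ) + t) = (k : ℝ) + t + 1 := fun k => by push_cast; ring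
  simp_rw [e] at this
  rw [this]
  exact intervalIntegral.integral_eq_integral_of_support_subset hsupp

/-- Continuity of the row integrand `u ↦ f(θ - 1/(c²(u+iy)))`. [folklore] -/
theorem continuous_rowIntegrand (hfc : Continuous f) (θ : ℝ) {C y : ℝ} (hC : C ≠ 0) (hy : y ≠ 0) :
    Continuous fun u : ℝ => f ((θ : ℂ) - 1 / ((C : ℂ) * ((u : ℂ) + (y : ℂ) * I))) := by
  refine hfc.comp (Continuous.sub continuous_const
    (Continuous.div continuous_const (by fun_prop) fun u => ?_))
  refine mul_ne_zero (ofReal_ne_zero.mpr hC) ?_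
  intro h; have := congrArg Complex.im h; simp at this; exact hy this

/-- The substitution `u = yt`: `∫_ℝ f(θ - 1/(c²(u+iy))) du = y ∫_ℝ f(θ - 1/(c²y(t+i))) dt`.
[folklore] -/
theorem rowIntegral_eq_mul (f : ℂ → ℂ) (θ C : ℝ) {y : ℝ} (hy : 0 < y) :
    ∫ u : ℝ, f ((θ : ℂ) - 1 / ((C : ℂ) * ((u : ℂ) + (y : ℂ) * I))) =
      (y : ℂ) * ∫ t : ℝ, f ((θ : ℂ) - 1 / (((C * y : ℝ) : ℂ) * ((t : ℂ) + I))) := by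
  have h := Measure.integral_comp_mul_left
    (fun u : ℝ => f ((θ : ℂ) - 1 / ((C : ℂ) * ((u : ℂ) + (y : ℂ) * I)))) y
  have e : ∀ t : ℝ, f ((θ : ℂ) - 1 / ((C : ℂ) * (((y * t : ℝ) : ℂ) + (y : ℂ) * I))) =
      f ((θ : ℂ) - 1 / (((C * y : ℝ) : ℂ) * ((t : ℂ) + I))) := by
    intro t; congr 3; push_cast; ring
  simp_rw [e] at h
  rw [h, abs_of_pos (inv_pos.mpr hy), Complex.real_smul, ← mul_assoc, ← ofReal_mul,
    mul_inv_cancel₀ hy.ne', ofReal_one, one_mul]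

/-- **The row `c ≥ 1`.** Regroup `d = c(k - M) + r` (`0 ≤ r < c`): for each residue `r` coprime
to `c` the `k`-sum tiles `ℝ`, giving `y Ψ(c²y, gcdA r c / c)`. [folklore] -/
theorem row_eq_sum_residues (hfc : Continuous f) (hper : ∀ z, f (z + 1) = f z)
    (hsupp : ∀ z, f z ≠ 0 → a ≤ z.im ∧ z.im ≤ b) (ha : 0 < a) {y : ℝ} (hy : 0 < y) {N : ℕ}
    (hN₀ : 1 / (a * y) ≤ N) (hN₁ : 1 / (a * y) * 1 + Real.sqrt (y / a) ≤ N) {c : ℕ} (hc : 1 ≤ c)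
    (hcN : c ≤ N) :
    (∑ d ∈ Finset.Icc (-(N : ℤ)) N, if IsCoprime (c : ℤ) d then
        ∫ x in (0:ℝ)..1, (if (c : ℤ) = 0 then f ((x : ℂ) + y * I) else
          f (((Int.gcdA d c : ℂ) * ((x : ℂ) + y * I) - (Int.gcdB d c : ℂ)) /
            (((c : ℤ) : ℂ) * ((x : ℂ) + y * I) + d))) else 0) =
      ∑ r ∈ (Finset.range c).filter (fun r => Nat.Coprime c r),
        (y : ℂ) * ∫ t : ℝ, f ((((Int.gcdA r c : ℝ) / c : ℝ) : ℂ) -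
          1 / (((((c : ℝ) ^ 2 * y : ℝ)) : ℂ) * ((t : ℂ) + I))) := by
  have hc0 : (c : ℤ) ≠ 0 := by exact_mod_cast (show c ≠ 0 by omega)
  have hc0' : (0 : ℤ) < c := by exact_mod_cast hc
  have hcR : (0 : ℝ) < c := by exact_mod_cast hc
  have hC : ((c : ℝ) ^ 2 : ℝ) ≠ 0 := by positivity
  simp only [hc0, if_false]
  set M : ℕ := N + 1 with hM
  -- the row integrand for the residue `r`
  set g : ℤ → ℝ → ℂ := fun r u => f ((((Int.gcdA r c : ℝ) / c : ℝ) : ℂ) -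
    1 / ((((c : ℝ) ^ 2 : ℝ)) * ((u : ℂ) + (y : ℂ) * I))) with hg
  -- the summand as a function of `d`
  set G : ℤ → ℂ := fun d => if IsCoprime (c : ℤ) d then
    ∫ x in (0:ℝ)..1, f (((Int.gcdA d c : ℂ) * ((x : ℂ) + y * I) - (Int.gcdB d c : ℂ)) /
      (((c : ℤ) : ℂ) * ((x : ℂ) + y * I) + d)) else 0 with hG
  -- `G` vanishes for `|d| > N` (box lemma)
  have hG0 : ∀ d : ℤ, (N : ℤ) < |d| → G d = 0 := by
    intro d hd
    simp only [hG]
    split_ifs with hcop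
    · have : ∀ x ∈ Set.uIcc (0 : ℝ) 1,
          f (((Int.gcdA d c : ℂ) * ((x : ℂ) + y * I) - (Int.gcdB d c : ℂ)) /
            (((c : ℤ) : ℂ) * ((x : ℂ) + y * I) + d)) = 0 := by
        intro x hx
        rw [Set.uIcc_of_le zero_le_one] at hx
        have hv : (![(c : ℤ), d] : Fin 2 → ℤ) ∉ pairBox N := by
          rw [mem_pairBox]; push Not; exact ⟨1, by simpa using hd⟩
        have := summand_eq_zero_of_not_mem_pairBox hsupp ha hy hN₀ hN₁ (z := ↑x + ↑y * I)
          (by simp) (by simp) (by simpa [abs_le] using And.intro (by linarith [hx.1]) hx.2)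
          (v := ![(c : ℤ), d]) (by simpa using hcop) hv
        have hcne : c ≠ 0 := by omega
        simpa [hc0, hcne] using this
      rw [intervalIntegral.integral_congr this]
      simp
    · rfl
  -- reindex by `d = c (k - M) + r`
  set idx : ℕ × ℕ → ℤ := fun p => (c : ℤ) * ((p.1 : ℤ) - M) + p.2 with hidx
  set P : Finset (ℕ × ℕ) := Finset.range (M + M + 1) ×ˢ Finset.range c with hP
  have hinj : Set.InjOn idx ↑P := by
    rintro ⟨k, r⟩ hkr ⟨k', r'⟩ hkr' heq
    simp only [hP, Finset.coe_product, Set.mem_prod, Finset.mem_coe, Finset.mem_range] at hkr hkr'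
    simp only [hidx] at heq
    have h1 := (Int.ediv_emod_unique (a := idx (k, r)) (b := (c : ℤ)) (r := (r : ℤ))
      (q := (k : ℤ) - M) hc0').mpr ⟨by simp only [hidx]; ring, by omega, by omega⟩
    have h2 := (Int.ediv_emod_unique (a := idx (k', r')) (b := (c : ℤ)) (r := (r' : ℤ))
      (q := (k' : ℤ) - M) hc0').mpr ⟨by simp only [hidx]; ring, by omega, by omega⟩
    have hkk : (k : ℤ) - M = k' - M := by rw [← h1.1, ← h2.1]; simp only [hidx, heq]
    have hrr : (r : ℤ) = r' := by rw [← h1.2, ← h2.2]; simp only [hidx, heq]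
    simp only [Prod.mk.injEq]; omega
  have hcover : Finset.Icc (-(N : ℤ)) N ⊆ P.image idx := by
    intro d hd
    rw [Finset.mem_Icc] at hd
    rw [Finset.mem_image]
    have hdec := (Int.ediv_emod_unique hc0' (a := d) (q := d / c) (r := d % c)).mp ⟨rfl, rfl⟩
    obtain ⟨hqr, hr0, hrc⟩ := hdec
    have hq1 : -(N : ℤ) ≤ d / c := by nlinarith
    have hq2 : d / c ≤ N := by nlinarith
    refine ⟨((d / c + M).toNat, (d % c).toNat), ?_, ?_⟩
    · simp only [hP, Finset.mem_product, Finset.mem_range]; omega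
    · simp only [hidx]
      rw [Int.toNat_of_nonneg (by omega), Int.toNat_of_nonneg hr0]
      linarith
  have step1 : ∑ d ∈ Finset.Icc (-(N : ℤ)) N, G d = ∑ p ∈ P, G (idx p) := by
    rw [← Finset.sum_image hinj]
    apply Finset.sum_subset hcover
    intro d hd hd'
    apply hG0
    rw [Finset.mem_Icc] at hd'
    rcases le_or_gt 0 d with h | h
    · rw [abs_of_nonneg h]; omega
    · rw [abs_of_neg h]; omega
  -- evaluate the summand at `idx (k, r)`
  have step2 : ∀ k r : ℕ, G (idx (k, r)) = if IsCoprime (c : ℤ) r then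
      ∫ u in ((k : ℝ) + (-(M : ℝ) + r / c))..((k : ℝ) + (-(M : ℝ) + r / c) + 1), g r u
      else 0 := by
    intro k r
    simp only [hG, hidx]
    have hiff : IsCoprime (c : ℤ) ((c : ℤ) * ((k : ℤ) - M) + r) ↔ IsCoprime (c : ℤ) (r : ℤ) := by
      rw [add_comm, IsCoprime.add_mul_left_right_iff]
    by_cases hcop : IsCoprime (c : ℤ) (r : ℤ)
    · rw [if_pos (hiff.mpr hcop), if_pos hcop, cell_eq_rowIntegral hc (hiff.mpr hcop) hy]
      -- the row integrand only depends on `r`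
      obtain ⟨n, hn⟩ := exists_gcdA_eq_add_mul hc0 hcop ((k : ℤ) - M)
      have hfun : (fun u : ℝ => f ((((Int.gcdA ((c : ℤ) * ((k : ℤ) - M) + r) c : ℝ) / c : ℝ) : ℂ) -
          1 / ((((c : ℝ) ^ 2 : ℝ)) * ((u : ℂ) + (y : ℂ) * I)))) = g r := by
        ext u
        simp only [hg, hn]
        have hcC' : ((c : ℕ) : ℂ) ≠ 0 := by exact_mod_cast (show c ≠ 0 by omega)
        have : ((((Int.gcdA r c + n * c : ℤ) : ℝ) / c : ℝ) : ℂ) =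
            ((((Int.gcdA r c : ℝ) / c : ℝ)) : ℂ) + n := by
          push_cast
          rw [add_div, mul_div_cancel_right₀ _ hcC']
        rw [this, add_sub_right_comm, periodic_int hper]
      rw [hfun]
      congr 1
      · push_cast; field_simp; ring
      · push_cast; field_simp; ring
    · rw [if_neg (fun h => hcop (hiff.mp h)), if_neg hcop]
  rw [step1, hP, Finset.sum_product_right]
  simp_rw [step2]
  -- the `k`-sum tiles `ℝ`
  have step3 : ∀ r ∈ Finset.range c,
      ∑ k ∈ Finset.range (M + M + 1),
        ∫ u in ((k : ℝ) + (-(M : ℝ) + r / c))..((k : ℝ) + (-(M : ℝ) + r / c) + 1), g r u =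
      ∫ u, g r u := by
    intro r hr
    rw [Finset.mem_range] at hr
    apply sum_integral_unit_intervals' (continuous_rowIntegrand hfc _ hC hy.ne')
    intro u hu
    have hu' := abs_le.mp ((abs_le_of_rowIntegrand_ne_zero hsupp ha hc hy hu).trans
      (le_trans (by linarith [show (0:ℝ) ≤ 1 / (a * y) * 1 by positivity]) hN₁))
    have hrc : (r : ℝ) / c < 1 := by rw [div_lt_one hcR]; exact_mod_cast hr
    have hrc' : 0 ≤ (r : ℝ) / c := by positivity
    have hMN : (M : ℝ) = N + 1 := by simp [hM]
    constructor
    · nlinarith [hu'.1]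
    · push_cast; nlinarith [hu'.2]
  have step4 : ∀ r ∈ Finset.range c,
      (∑ k ∈ Finset.range (M + M + 1), if IsCoprime (c : ℤ) r then
        ∫ u in ((k : ℝ) + (-(M : ℝ) + r / c))..((k : ℝ) + (-(M : ℝ) + r / c) + 1), g r u
        else 0) = if IsCoprime (c : ℤ) r then ∫ u, g r u else 0 := by
    intro r hr
    split_ifs with h
    · exact step3 r hr
    · simp
  rw [Finset.sum_congr rfl step4, ← Finset.sum_filter]
  have hfilter : (Finset.range c).filter (fun r : ℕ => IsCoprime (c : ℤ) (r : ℤ)) =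
      (Finset.range c).filter (fun r => Nat.Coprime c r) :=
    Finset.filter_congr fun r _ => Nat.isCoprime_iff_coprime
  rw [hfilter]
  refine Finset.sum_congr rfl fun r _ => ?_
  simp only [hg]
  exact rowIntegral_eq_mul f _ _ hy


/-! ### Step 4: residues `r ↦ r⁻¹ (mod c)` and the unfolded horocycle average -/

/-- **Inversion of reduced residues.** For a `1`-periodic `h` and `c ≥ 1`,
`∑_{r mod c, (r,c)=1} h(gcdA r c / c) = ∑_{a mod c, (a,c)=1} h(a/c)`: `r ↦ gcdA r c mod c` is the
inversion on `(ℤ/c)ˣ`. [folklore] -/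
theorem sum_coprime_gcdA_eq {h : ℝ → ℂ} (hh : Function.Periodic h 1) {c : ℕ} (hc : 1 ≤ c) :
    ∑ r ∈ (Finset.range c).filter (fun r => Nat.Coprime c r), h ((Int.gcdA r c : ℝ) / c) =
      ∑ r ∈ (Finset.range c).filter (fun r => Nat.Coprime c r), h ((r : ℝ) / c) := by
  have hc0 : (0 : ℤ) < c := by exact_mod_cast hc
  have hc0' : (c : ℤ) ≠ 0 := hc0.ne'
  have hcR : (c : ℝ) ≠ 0 := by exact_mod_cast (show c ≠ 0 by omega)
  -- Bezout data for `r` coprime to `c`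
  have hbez : ∀ r : ℕ, Nat.Coprime c r → Int.gcdA r c * r + Int.gcdB r c * c = 1 := fun r hr =>
    gcdA_mul_add_gcdB_mul (Nat.isCoprime_iff_coprime.mpr hr)
  set i : ℕ → ℕ := fun r => (Int.gcdA r c % c).toNat with hi
  have hi_cast : ∀ r : ℕ, ((i r : ℕ) : ℤ) = Int.gcdA r c % c := fun r =>
    Int.toNat_of_nonneg (Int.emod_nonneg _ hc0')
  have hmem : ∀ r ∈ (Finset.range c).filter (fun r => Nat.Coprime c r),
      i r ∈ (Finset.range c).filter (fun r => Nat.Coprime c r) := by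
    intro r hr
    rw [Finset.mem_filter, Finset.mem_range] at hr ⊢
    constructor
    · have : ((i r : ℕ) : ℤ) < c := by rw [hi_cast]; exact Int.emod_lt_of_pos _ hc0
      exact_mod_cast this
    · rw [← Nat.isCoprime_iff_coprime, hi_cast, Int.emod_def,
        show Int.gcdA r c - (c : ℤ) * (Int.gcdA r c / c) =
          Int.gcdA r c + (c : ℤ) * (-(Int.gcdA r c / c)) by ring,
        IsCoprime.add_mul_left_right_iff]
      exact ⟨Int.gcdB r c, r, by linarith [hbez r hr.2]⟩
  have hinj : Set.InjOn i ↑((Finset.range c).filter (fun r => Nat.Coprime c r)) := by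
    intro r₁ hr₁ r₂ hr₂ heq
    simp only [Finset.coe_filter, Finset.mem_range, Set.mem_setOf_eq] at hr₁ hr₂
    have h1 := hbez r₁ hr₁.2
    have h2 := hbez r₂ hr₂.2
    have hmod : Int.gcdA r₁ c % c = Int.gcdA r₂ c % c := by
      rw [← hi_cast, ← hi_cast]; exact_mod_cast heq
    have hdvd : (c : ℤ) ∣ Int.gcdA r₂ c - Int.gcdA r₁ c := (Int.ModEq.dvd hmod)
    obtain ⟨m, hm⟩ := hdvd
    have hdvd' : (c : ℤ) ∣ (r₁ : ℤ) - r₂ := by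
      refine ⟨(r₁ : ℤ) * r₂ * m + (r₁ * Int.gcdB r₂ c - r₂ * Int.gcdB r₁ c), ?_⟩
      have e : (r₁ : ℤ) - r₂ = r₁ * (Int.gcdA r₂ c * r₂ + Int.gcdB r₂ c * c) -
          r₂ * (Int.gcdA r₁ c * r₁ + Int.gcdB r₁ c * c) := by rw [h1, h2]; ring
      rw [e]
      linear_combination (r₁ : ℤ) * r₂ * hm
    have habs : |(r₁ : ℤ) - r₂| < c := by
      rw [abs_lt]; constructor <;> omega
    have := Int.eq_zero_of_abs_lt_dvd hdvd' habs
    omega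
  refine Finset.sum_nbij i hmem hinj
    (Finset.surjOn_of_injOn_of_card_le i hmem hinj le_rfl) ?_
  intro r _
  -- `gcdA r c / c = (gcdA r c % c)/c + ⌊gcdA r c / c⌋`
  have e : (Int.gcdA r c : ℝ) / c = ((i r : ℕ) : ℝ) / c + ((Int.gcdA r c / c : ℤ) : ℝ) * 1 := by
    have h1 : ((i r : ℕ) : ℝ) = ((Int.gcdA r c % c : ℤ) : ℝ) := by exact_mod_cast hi_cast r
    have h2 : ((Int.gcdA r c : ℤ) : ℝ) =
        ((Int.gcdA r c % c : ℤ) : ℝ) + (c : ℝ) * ((Int.gcdA r c / c : ℤ) : ℝ) := by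
      have := Int.emod_add_mul_ediv (Int.gcdA r c) c
      exact_mod_cast congrArg (fun z : ℤ => (z : ℝ)) this.symm
    rw [h1, mul_one, h2, add_div, mul_div_cancel_left₀ _ hcR]
  rw [e]
  exact hh.int_mul _ _

/-- **Unfolded horocycle average of the incomplete Poincaré series of a strip test**
(Iwaniec, *Spectral methods*, §3.4; Zagier 1981 §1 (10)): for `y > 0` and `N` large,
`∫₀¹ P_f(x+iy) dx = 2 ∫₀¹ f(x+iy) dx + 2 ∑_{1 ≤ c ≤ N} y ∑_{a mod c, (a,c)=1} Ψ(c²y, a/c)`,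
`P_f(z) = ∑_{(c,d)=1} T_f((c,d), z)`, `Ψ(w,θ) = ∫_ℝ f(θ - 1/(w(t+i))) dt`. [cite: Iwaniec2002, §3.4] -/
theorem horocycleAverage_poincare (hfc : Continuous f) (hper : ∀ z, f (z + 1) = f z)
    (hsupp : ∀ z, f z ≠ 0 → a ≤ z.im ∧ z.im ≤ b) (ha : 0 < a) {y : ℝ} (hy : 0 < y) {N : ℕ}
    (hN₀ : 1 / (a * y) ≤ N) (hN₁ : 1 / (a * y) * 1 + Real.sqrt (y / a) ≤ N) :
    ∫ x in (0:ℝ)..1, (∑' v : coprimePairs, (if v.1 0 = 0 then f ((x : ℂ) + y * I) else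
      f (((Int.gcdA (v.1 1) (v.1 0) : ℂ) * ((x : ℂ) + y * I) - (Int.gcdB (v.1 1) (v.1 0) : ℂ)) /
        ((v.1 0 : ℂ) * ((x : ℂ) + y * I) + v.1 1)))) =
      (2 * ∫ x in (0:ℝ)..1, f ((x : ℂ) + y * I)) +
        2 * ∑ c ∈ Finset.Ioc 0 N, (y : ℂ) *
          ∑ r ∈ (Finset.range c).filter (fun r => Nat.Coprime c r),
            ∫ t : ℝ, f ((((r : ℝ) / c : ℝ) : ℂ) - 1 / (((((c : ℝ) ^ 2 * y : ℝ)) : ℂ) * ((t : ℂ) + I))) := by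
  have hN1 : 1 ≤ N := by
    have : (0:ℝ) < N := lt_of_lt_of_le (by positivity) hN₀
    exact_mod_cast this
  rw [horocycle_integral_eq_boxSum hfc hsupp ha hy hN₀ hN₁]
  rw [sum_pairBox_eq' N (fun c d => if IsCoprime c d then
    ∫ x in (0:ℝ)..1, (if c = 0 then f ((x : ℂ) + y * I) else
      f (((Int.gcdA d c : ℂ) * ((x : ℂ) + y * I) - (Int.gcdB d c : ℂ)) /
        ((c : ℂ) * ((x : ℂ) + y * I) + d))) else 0)]
  rw [sum_Icc_symm' (h := fun c : ℤ => ∑ d ∈ Finset.Icc (-(N : ℤ)) N, if IsCoprime c d then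
    ∫ x in (0:ℝ)..1, (if c = 0 then f ((x : ℂ) + y * I) else
      f (((Int.gcdA d c : ℂ) * ((x : ℂ) + y * I) - (Int.gcdB d c : ℂ)) /
        ((c : ℂ) * ((x : ℂ) + y * I) + d))) else 0) (fun c => row_neg hper hy N c) N]
  rw [row_zero f y hN1]
  congr 1
  congr 1
  rw [HorocycleZeroMode.sum_Ioc_zero_eq_sum_range]
  refine Finset.sum_congr rfl fun k hk => ?_
  rw [Finset.mem_range] at hk
  have e1 : ((k + 1 : ℕ) : ℤ) = (k : ℤ) + 1 := by push_cast; ring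
  rw [← e1, row_eq_sum_residues hfc hper hsupp ha hy hN₀ hN₁ (c := k + 1) (by omega) (by omega),
    ← Finset.mul_sum]
  congr 1
  have hperΨ : Function.Periodic (fun θ : ℝ => ∫ t : ℝ, f ((θ : ℂ) -
      1 / ((((((k + 1 : ℕ) : ℝ) ^ 2 * y : ℝ)) : ℂ) * ((t : ℂ) + I)))) 1 := fun θ =>
    integral_apply_hpt_add_one hper _ θ
  exact sum_coprime_gcdA_eq hperΨ (by omega)

end HorocycleUnfolding

end Literature.NumberTheory.LFunctions

end
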